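/-
Copyright: the b2b-balaban T⁴-continuum CRUX team, row NE7b OWNER lineage `t4-ne7b-p1` (gen 131). Project licence.
-/
import Mathlib.Analysis.Calculus.Deriv.MeanValue
import Summits.QuantumFields.BalabanUV.T4Continuum.Spine.NE7b.SupNextPotentialThirdLetter

/-!
# THE CUBIC TAYLOR LETTER OF THE NEXT POTENTIAL BETWEEN TWO EXTERNAL FIELDS: (A) third-order Taylor estimates on `[0, s]` from `HasDerivAt`
# chains and a bound `|g‴| ≤ M` — by MONOTONICITY, no continuity of `g‴` (`|g(t) − g(0) − tg′(0) − ½t²g″(0)| ≤ Mt³∕6` and its two companions);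
# (B) on the road's step `Z(t) = ∫e^{−V_t}dN(0,Γ)` along `ψ₀ + t·h` ((336b)∕(337b)): with the single-site tilted moment letters `L₁, L₂, L₃`
# UNIFORM on the segment,
#   `|log Z(ψ₀+h) − log Z(ψ₀) − (log Z)′(0) − ½(log Z)″(0)| ≤ (E₃ + 3E₁E₂ + 2E₁³)∕6`
# together with the second- and first-order companions — THE THIRD-ORDER RE-ENTRY of the next remainder `W⁺ = −log Z` in the direction `h`
# with the HONEST O(1)·‖h‖³ letter of (337b) (row NE7b, node U5c; (337b) BY NAME; [folklore])

Cell `pub-balaban`, sub-cell `t4`, spine estimate NE7b (`T4WeightBudget.RelWeightBound`; the cell's OWN estimate — NOT PRINTED in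
[Bałaban 1983–89], NOT PROVED).  Crux-route work under `Spine/NE7b/` by the row OWNER (`t4-ne7b-p1` gen 131, file (338)) under FREEZE
(0)'s crux-prover clause, on § [NE7bP1-G130-HANDOFF] NEXT (3)(a) ∕ ADDENDUM («then … add the 1-D Taylor glue ((290) pattern) ⟹ the next
remainder's cubic letter»); NOTHING of Bałaban's is named as a Lean object, valued or asserted; no `T4Continuum/Support` leaf typed; no `def`,
no notation; zero `sorry`.  Imports (BY NAME): the OWNER's (337b) `…SupNextPotentialThirdLetter` (`logZ_derivs_line`, `third_letter_line`);
Mathlib's `antitoneOn_of_deriv_nonpos`, `hasDerivAt_pow`.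

WHAT IS PROVED ([folklore]):
* §1 (A) `le_init_of_hasDerivAt_nonpos` (`φ′ ≤ 0` on `[0,s]` ⟹ `φ ≤ φ(0)` there), `taylor_third_upper` (one-sided: `g‴ ≤ M` ⟹
  `g₂(t) − g₂(0) ≤ Mt`, `g₁(t) − g₁(0) − tg₂(0) ≤ Mt²∕2`, `g(t) − g(0) − tg₁(0) − ½t²g₂(0) ≤ Mt³∕6`), **`taylor_third_abs`** (`|g‴| ≤ M` ⟹ the
  three absolute letters on `[0,s]`), `taylor_third_abs_one` (endpoint form on `[0,1]`: `M∕6`, `M∕2`, `M`);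
* §2 (B) THE END **`cubic_taylor_line`**: under (336b)'s hypotheses and the three tilted moment letters at every `t ∈ [0,1]`,
  `|log Z(ψ₀+h) − log Z(ψ₀) − Z′(0)∕Z(0) − ½(Z″Z − Z′Z′)(0)∕Z(0)²| ≤ (E₃ + 3E₁E₂ + 2E₁³)∕6`, `|(Z′∕Z)(1) − (Z′∕Z)(0) − (Z″Z − Z′Z′)(0)∕Z(0)²| ≤
  (E₃ + 3E₁E₂ + 2E₁³)∕2`, `|(Z″Z − Z′Z′)∕Z²(1) − (Z″Z − Z′Z′)∕Z²(0)| ≤ E₃ + 3E₁E₂ + 2E₁³` (`E₁ = κ₁Σ|h|L₁`, `E₂ = κ₁²#YΣh²L₂ + κ₂Σh²`,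
  `E₃ = κ₁³#Y²Σ|h|³L₃ + 3κ₂Σh²·κ₁Σ|h|L₁ + κ₃Σ|h|³`); §3 toy.

HONEST (what this is NOT).  The letters `L_k` uniform on the segment are hypotheses (on the road: (329)'s single-site tilted moments while
`ψ₀ + th` stays in the small-field ball — the successor's discharge); the constant is O(1)·(Σ|h|)³ on the same sites: NO contraction of the
cubic letter without blocking ∕ rescaling (SCOPING-d4); scalar skeleton ((A3), NC-NE7b-α UNRULED); nothing of Bałaban's asserted.  BY-NAME
EFFECT ON THE WALL: NONE.  NE7b NOT PRINTED ∕ NOT PROVED; spine PROVED 0∕9; rung (B)+1 — the programme's measures remain FINITE-torus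
statements; NOT the mass gap, NOT Clay.  HONEST DEPENDENCY: continuum YM on T⁴ ⇐ BetaPertH ∧ nine spine estimates (0∕9 proved); BetaPertH ⇐
(D1) ∧ (D4) ∧ CAP+tail; G-an2-4 gates asym, D1 and NE2∕3∕4.
-/

set_option autoImplicit false

noncomputable section

namespace Summit.QuantumFields.BalabanUV.T4Continuum.NE7b.SupNextPotentialCubicTaylor

open MeasureTheory ProbabilityTheory Finset Real Set
open scoped BigOperators
open SupNextPotentialThirdLetter (logZ_derivs_line third_letter_line)

/-! ## §1. Third-order Taylor letters from a bound on the third derivative (monotonicity, no continuity of `g‴`) -/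

/-- `φ′ ≤ 0` on `[0, s]` (derivatives `HasDerivAt` at every point of the closed interval) ⟹ `φ(t) ≤ φ(0)` on `[0, s]`. [folklore] -/
theorem le_init_of_hasDerivAt_nonpos {φ φ' : ℝ → ℝ} {s : ℝ} (hs : 0 ≤ s) (hφ : ∀ t ∈ Icc 0 s, HasDerivAt φ (φ' t) t)
    (hle : ∀ t ∈ Icc 0 s, φ' t ≤ 0) : ∀ t ∈ Icc 0 s, φ t ≤ φ 0 := by
  have hanti : AntitoneOn φ (Icc 0 s) :=
    antitoneOn_of_deriv_nonpos (convex_Icc 0 s) (fun t ht => (hφ t ht).continuousAt.continuousWithinAt)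
      (fun t ht => (hφ t (interior_subset ht)).differentiableAt.differentiableWithinAt)
      (fun t ht => by rw [(hφ t (interior_subset ht)).deriv]; exact hle t (interior_subset ht))
  intro t ht
  exact hanti (left_mem_Icc.2 hs) ht ht.1

/-- **One-sided third-order Taylor letters**: `g′ = g₁`, `g₁′ = g₂`, `g₂′ = g₃` on `[0, s]` and `g₃ ≤ M` there ⟹ for `t ∈ [0, s]`:
`g₂(t) − g₂(0) ≤ Mt`, `g₁(t) − g₁(0) − t·g₂(0) ≤ Mt²∕2`, `g(t) − g(0) − t·g₁(0) − ½t²·g₂(0) ≤ Mt³∕6`. [folklore] -/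
theorem taylor_third_upper {g g₁ g₂ g₃ : ℝ → ℝ} {s M : ℝ} (hs : 0 ≤ s) (hg : ∀ t ∈ Icc 0 s, HasDerivAt g (g₁ t) t)
    (hg₁ : ∀ t ∈ Icc 0 s, HasDerivAt g₁ (g₂ t) t) (hg₂ : ∀ t ∈ Icc 0 s, HasDerivAt g₂ (g₃ t) t) (hM : ∀ t ∈ Icc 0 s, g₃ t ≤ M) :
    (∀ t ∈ Icc 0 s, g₂ t - g₂ 0 ≤ M * t) ∧ (∀ t ∈ Icc 0 s, g₁ t - g₁ 0 - t * g₂ 0 ≤ M * t ^ 2 / 2) ∧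
      (∀ t ∈ Icc 0 s, g t - g 0 - t * g₁ 0 - t ^ 2 / 2 * g₂ 0 ≤ M * t ^ 3 / 6) := by
  -- second derivative
  have h2 : ∀ t ∈ Icc 0 s, g₂ t - g₂ 0 - M * t ≤ g₂ 0 - g₂ 0 - M * 0 := by
    refine le_init_of_hasDerivAt_nonpos (φ := fun t => g₂ t - g₂ 0 - M * t) (φ' := fun t => g₃ t - M) hs (fun t ht => ?_)
      (fun t ht => by linarith [hM t ht])
    exact (((hg₂ t ht).sub_const (g₂ 0)).sub ((hasDerivAt_id' t).const_mul M)).congr_deriv (by ring)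
  have h2' : ∀ t ∈ Icc 0 s, g₂ t - g₂ 0 ≤ M * t := fun t ht => by linarith [h2 t ht]
  -- first derivative
  have h1 : ∀ t ∈ Icc 0 s, g₁ t - g₁ 0 - t * g₂ 0 - M * t ^ 2 / 2 ≤ g₁ 0 - g₁ 0 - 0 * g₂ 0 - M * (0 : ℝ) ^ 2 / 2 := by
    refine le_init_of_hasDerivAt_nonpos (φ := fun t => g₁ t - g₁ 0 - t * g₂ 0 - M * t ^ 2 / 2)
      (φ' := fun t => g₂ t - g₂ 0 - M * t) hs (fun t ht => ?_) (fun t ht => by linarith [h2' t ht])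
    have h := (((hg₁ t ht).sub_const (g₁ 0)).sub ((hasDerivAt_id' t).mul_const (g₂ 0))).sub
      (((hasDerivAt_pow 2 t).const_mul M).div_const 2)
    refine h.congr_deriv ?_
    push_cast
    ring
  have h1' : ∀ t ∈ Icc 0 s, g₁ t - g₁ 0 - t * g₂ 0 ≤ M * t ^ 2 / 2 := fun t ht => by
    have := h1 t ht
    norm_num at this
    linarith
  -- the function
  have h0 : ∀ t ∈ Icc 0 s, g t - g 0 - t * g₁ 0 - t ^ 2 / 2 * g₂ 0 - M * t ^ 3 / 6 ≤
      g 0 - g 0 - 0 * g₁ 0 - (0 : ℝ) ^ 2 / 2 * g₂ 0 - M * (0 : ℝ) ^ 3 / 6 := by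
    refine le_init_of_hasDerivAt_nonpos (φ := fun t => g t - g 0 - t * g₁ 0 - t ^ 2 / 2 * g₂ 0 - M * t ^ 3 / 6)
      (φ' := fun t => g₁ t - g₁ 0 - t * g₂ 0 - M * t ^ 2 / 2) hs (fun t ht => ?_) (fun t ht => by linarith [h1' t ht])
    have h := ((((hg t ht).sub_const (g 0)).sub ((hasDerivAt_id' t).mul_const (g₁ 0))).sub
      (((hasDerivAt_pow 2 t).div_const 2).mul_const (g₂ 0))).sub (((hasDerivAt_pow 3 t).const_mul M).div_const 6)
    refine h.congr_deriv ?_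
    push_cast
    ring
  have h0' : ∀ t ∈ Icc 0 s, g t - g 0 - t * g₁ 0 - t ^ 2 / 2 * g₂ 0 ≤ M * t ^ 3 / 6 := fun t ht => by
    have := h0 t ht
    norm_num at this
    linarith
  exact ⟨h2', h1', h0'⟩

/-- **Third-order Taylor letters**: `g′ = g₁`, `g₁′ = g₂`, `g₂′ = g₃` on `[0, s]` and `|g₃| ≤ M` there ⟹ for `t ∈ [0, s]`:
`|g₂(t) − g₂(0)| ≤ Mt`, `|g₁(t) − g₁(0) − t·g₂(0)| ≤ Mt²∕2`, `|g(t) − g(0) − t·g₁(0) − ½t²·g₂(0)| ≤ Mt³∕6`. [folklore] -/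
theorem taylor_third_abs {g g₁ g₂ g₃ : ℝ → ℝ} {s M : ℝ} (hs : 0 ≤ s) (hg : ∀ t ∈ Icc 0 s, HasDerivAt g (g₁ t) t)
    (hg₁ : ∀ t ∈ Icc 0 s, HasDerivAt g₁ (g₂ t) t) (hg₂ : ∀ t ∈ Icc 0 s, HasDerivAt g₂ (g₃ t) t) (hM : ∀ t ∈ Icc 0 s, |g₃ t| ≤ M) :
    (∀ t ∈ Icc 0 s, |g₂ t - g₂ 0| ≤ M * t) ∧ (∀ t ∈ Icc 0 s, |g₁ t - g₁ 0 - t * g₂ 0| ≤ M * t ^ 2 / 2) ∧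
      (∀ t ∈ Icc 0 s, |g t - g 0 - t * g₁ 0 - t ^ 2 / 2 * g₂ 0| ≤ M * t ^ 3 / 6) := by
  obtain ⟨u2, u1, u0⟩ := taylor_third_upper hs hg hg₁ hg₂ (fun t ht => (le_abs_self _).trans (hM t ht))
  obtain ⟨l2, l1, l0⟩ := taylor_third_upper (g := fun t => -g t) (g₁ := fun t => -g₁ t) (g₂ := fun t => -g₂ t)
    (g₃ := fun t => -g₃ t) (M := M) hs (fun t ht => (hg t ht).neg) (fun t ht => (hg₁ t ht).neg) (fun t ht => (hg₂ t ht).neg)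
    (fun t ht => (neg_le_abs _).trans (hM t ht))
  refine ⟨fun t ht => abs_le.2 ⟨?_, u2 t ht⟩, fun t ht => abs_le.2 ⟨?_, u1 t ht⟩, fun t ht => abs_le.2 ⟨?_, u0 t ht⟩⟩
  · have := l2 t ht; linarith
  · have := l1 t ht; linarith
  · have := l0 t ht; linarith

/-- **The endpoint form on `[0, 1]`**: `|g(1) − g(0) − g₁(0) − ½g₂(0)| ≤ M∕6`, `|g₁(1) − g₁(0) − g₂(0)| ≤ M∕2`, `|g₂(1) − g₂(0)| ≤ M`. [folklore] -/
theorem taylor_third_abs_one {g g₁ g₂ g₃ : ℝ → ℝ} {M : ℝ} (hg : ∀ t ∈ Icc (0 : ℝ) 1, HasDerivAt g (g₁ t) t)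
    (hg₁ : ∀ t ∈ Icc (0 : ℝ) 1, HasDerivAt g₁ (g₂ t) t) (hg₂ : ∀ t ∈ Icc (0 : ℝ) 1, HasDerivAt g₂ (g₃ t) t)
    (hM : ∀ t ∈ Icc (0 : ℝ) 1, |g₃ t| ≤ M) :
    |g 1 - g 0 - g₁ 0 - g₂ 0 / 2| ≤ M / 6 ∧ |g₁ 1 - g₁ 0 - g₂ 0| ≤ M / 2 ∧ |g₂ 1 - g₂ 0| ≤ M := by
  obtain ⟨a2, a1, a0⟩ := taylor_third_abs zero_le_one hg hg₁ hg₂ hM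
  have h1 : (1 : ℝ) ∈ Icc (0 : ℝ) 1 := right_mem_Icc.2 zero_le_one
  refine ⟨?_, ?_, ?_⟩
  · have := a0 1 h1; norm_num at this; simpa [div_eq_mul_inv, mul_comm] using this
  · have := a1 1 h1; norm_num at this; exact this
  · have := a2 1 h1; norm_num at this; exact this


/-! ## §2. THE END: the cubic Taylor letter of `log Z` between `ψ₀` and `ψ₀ + h` -/

section Main

variable {ι : Type} [Fintype ι] [DecidableEq ι]
variable {Γ : Matrix ι ι ℝ} {γop : ℝ} {w w' w'' w₃ : ι → ℝ → ℝ} {κ₀ κ₁ κ₂ κ₃ τ δ θ : ℝ}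

/-- **THE CUBIC TAYLOR LETTER OF THE NEXT POTENTIAL.**  Under (336b)'s hypotheses (`Γ ⪰ 0`, `Γ ⪯ γ_op·1`, `C³` remainders with the four
letters, `0 < τ, δ`, `0 ≤ θ < 1`, `(2κ₀(1+τ)+4δ)γ_op ≤ θ`) and the single-site tilted moment letters `∫e^{−V_t}|u_x| ≤ Z(t)L₁`,
`∫e^{−V_t}u_x² ≤ Z(t)L₂`, `∫e^{−V_t}|u_x|³ ≤ Z(t)L₃` for every `t ∈ [0,1]` and `x ∈ Y` (`u_x = ω_x + ψ₀,x + th_x`): the third-, second- and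
first-order Taylor remainders of `t ↦ log Z(ψ₀ + th)` between `t = 0` and `t = 1` are at most `M∕6`, `M∕2`, `M` with
`M = E₃ + 3E₁E₂ + 2E₁³`. [folklore] -/
theorem cubic_taylor_line (hΓ : Γ.PosSemidef) (hΓop : (γop • (1 : Matrix ι ι ℝ) - Γ).PosSemidef) (Y : Finset ι)
    (hw' : ∀ x t, HasDerivAt (w x) (w' x t) t) (hw'' : ∀ x t, HasDerivAt (w' x) (w'' x t) t) (hw₃ : ∀ x t, HasDerivAt (w'' x) (w₃ x t) t)
    (hw₃m : ∀ x, Measurable (w₃ x)) (hκ₀ : 0 ≤ κ₀) (hκ₁ : 0 ≤ κ₁) (hκ₂ : 0 ≤ κ₂) (hκ₃ : 0 ≤ κ₃) (hτ : 0 < τ) (hδ : 0 < δ) (hθ0 : 0 ≤ θ)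
    (hθ1 : θ < 1) (hκθ : (2 * κ₀ * (1 + τ) + 4 * δ) * γop ≤ θ) (hstab : ∀ x, ∀ u : ℝ, -(κ₀ * u ^ 2) ≤ w x u)
    (hw'b : ∀ x u, |w' x u| ≤ κ₁ * |u|) (hw''b : ∀ x u, |w'' x u| ≤ κ₂) (hw₃b : ∀ x u, |w₃ x u| ≤ κ₃) (ψ₀ h : ι → ℝ)
    {L₁ L₂ L₃ : ℝ}
    (hI1 : ∀ t ∈ Set.Icc (0 : ℝ) 1, ∀ x ∈ Y, Integrable (fun ω : EuclideanSpace ℝ ι => exp (-(∑ x ∈ Y, w x (ω x + (ψ₀ x + t * h x)))) * |(ω x + (ψ₀ x + t * h x))|) (multivariateGaussian 0 Γ))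
    (hL1 : ∀ t ∈ Set.Icc (0 : ℝ) 1, ∀ x ∈ Y, ∫ ω : EuclideanSpace ℝ ι, exp (-(∑ x ∈ Y, w x (ω x + (ψ₀ x + t * h x)))) * |(ω x + (ψ₀ x + t * h x))| ∂(multivariateGaussian 0 Γ) ≤
      (∫ ω : EuclideanSpace ℝ ι, exp (-(∑ x ∈ Y, w x (ω x + (ψ₀ x + t * h x)))) ∂(multivariateGaussian 0 Γ)) * L₁)
    (hI2 : ∀ t ∈ Set.Icc (0 : ℝ) 1, ∀ x ∈ Y, Integrable (fun ω : EuclideanSpace ℝ ι => exp (-(∑ x ∈ Y, w x (ω x + (ψ₀ x + t * h x)))) * (ω x + (ψ₀ x + t * h x)) ^ 2) (multivariateGaussian 0 Γ))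
    (hL2 : ∀ t ∈ Set.Icc (0 : ℝ) 1, ∀ x ∈ Y, ∫ ω : EuclideanSpace ℝ ι, exp (-(∑ x ∈ Y, w x (ω x + (ψ₀ x + t * h x)))) * (ω x + (ψ₀ x + t * h x)) ^ 2 ∂(multivariateGaussian 0 Γ) ≤
      (∫ ω : EuclideanSpace ℝ ι, exp (-(∑ x ∈ Y, w x (ω x + (ψ₀ x + t * h x)))) ∂(multivariateGaussian 0 Γ)) * L₂)
    (hI3 : ∀ t ∈ Set.Icc (0 : ℝ) 1, ∀ x ∈ Y, Integrable (fun ω : EuclideanSpace ℝ ι => exp (-(∑ x ∈ Y, w x (ω x + (ψ₀ x + t * h x)))) * |(ω x + (ψ₀ x + t * h x))| ^ 3) (multivariateGaussian 0 Γ))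
    (hL3 : ∀ t ∈ Set.Icc (0 : ℝ) 1, ∀ x ∈ Y, ∫ ω : EuclideanSpace ℝ ι, exp (-(∑ x ∈ Y, w x (ω x + (ψ₀ x + t * h x)))) * |(ω x + (ψ₀ x + t * h x))| ^ 3 ∂(multivariateGaussian 0 Γ) ≤
      (∫ ω : EuclideanSpace ℝ ι, exp (-(∑ x ∈ Y, w x (ω x + (ψ₀ x + t * h x)))) ∂(multivariateGaussian 0 Γ)) * L₃) :
    |Real.log (∫ ω : EuclideanSpace ℝ ι, exp (-(∑ x ∈ Y, w x (ω x + (ψ₀ x + h x)))) ∂(multivariateGaussian 0 Γ)) -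
          Real.log (∫ ω : EuclideanSpace ℝ ι, exp (-(∑ x ∈ Y, w x (ω x + ψ₀ x))) ∂(multivariateGaussian 0 Γ)) -
        (∫ ω : EuclideanSpace ℝ ι, exp (-(∑ x ∈ Y, w x (ω x + ψ₀ x))) * -(∑ x ∈ Y, w' x (ω x + ψ₀ x) * h x) ∂(multivariateGaussian 0 Γ)) /
          (∫ ω : EuclideanSpace ℝ ι, exp (-(∑ x ∈ Y, w x (ω x + ψ₀ x))) ∂(multivariateGaussian 0 Γ)) -
        ((∫ ω : EuclideanSpace ℝ ι, exp (-(∑ x ∈ Y, w x (ω x + ψ₀ x))) * ((∑ x ∈ Y, w' x (ω x + ψ₀ x) * h x) * (∑ x ∈ Y, w' x (ω x + ψ₀ x) * h x) - (∑ x ∈ Y, w'' x (ω x + ψ₀ x) * h x ^ 2)) ∂(multivariateGaussian 0 Γ)) *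
            (∫ ω : EuclideanSpace ℝ ι, exp (-(∑ x ∈ Y, w x (ω x + ψ₀ x))) ∂(multivariateGaussian 0 Γ)) -
          (∫ ω : EuclideanSpace ℝ ι, exp (-(∑ x ∈ Y, w x (ω x + ψ₀ x))) * -(∑ x ∈ Y, w' x (ω x + ψ₀ x) * h x) ∂(multivariateGaussian 0 Γ)) *
            (∫ ω : EuclideanSpace ℝ ι, exp (-(∑ x ∈ Y, w x (ω x + ψ₀ x))) * -(∑ x ∈ Y, w' x (ω x + ψ₀ x) * h x) ∂(multivariateGaussian 0 Γ))) /
          (∫ ω : EuclideanSpace ℝ ι, exp (-(∑ x ∈ Y, w x (ω x + ψ₀ x))) ∂(multivariateGaussian 0 Γ)) ^ 2 / 2| ≤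
      ((κ₁ ^ 3 * (Y.card : ℝ) ^ 2 * (∑ x ∈ Y, |h x| ^ 3) * L₃ + 3 * (κ₂ * (∑ x ∈ Y, h x ^ 2)) * (κ₁ * (∑ x ∈ Y, |h x|) * L₁) + κ₃ * (∑ x ∈ Y, |h x| ^ 3)) +
          3 * (κ₁ * (∑ x ∈ Y, |h x|) * L₁) * (κ₁ ^ 2 * Y.card * (∑ x ∈ Y, h x ^ 2) * L₂ + κ₂ * (∑ x ∈ Y, h x ^ 2)) + 2 * (κ₁ * (∑ x ∈ Y, |h x|) * L₁) ^ 3) / 6 ∧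
    |(∫ ω : EuclideanSpace ℝ ι, exp (-(∑ x ∈ Y, w x (ω x + (ψ₀ x + h x)))) * -(∑ x ∈ Y, w' x (ω x + (ψ₀ x + h x)) * h x) ∂(multivariateGaussian 0 Γ)) /
          (∫ ω : EuclideanSpace ℝ ι, exp (-(∑ x ∈ Y, w x (ω x + (ψ₀ x + h x)))) ∂(multivariateGaussian 0 Γ)) -
        (∫ ω : EuclideanSpace ℝ ι, exp (-(∑ x ∈ Y, w x (ω x + ψ₀ x))) * -(∑ x ∈ Y, w' x (ω x + ψ₀ x) * h x) ∂(multivariateGaussian 0 Γ)) /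
          (∫ ω : EuclideanSpace ℝ ι, exp (-(∑ x ∈ Y, w x (ω x + ψ₀ x))) ∂(multivariateGaussian 0 Γ)) -
        ((∫ ω : EuclideanSpace ℝ ι, exp (-(∑ x ∈ Y, w x (ω x + ψ₀ x))) * ((∑ x ∈ Y, w' x (ω x + ψ₀ x) * h x) * (∑ x ∈ Y, w' x (ω x + ψ₀ x) * h x) - (∑ x ∈ Y, w'' x (ω x + ψ₀ x) * h x ^ 2)) ∂(multivariateGaussian 0 Γ)) *
            (∫ ω : EuclideanSpace ℝ ι, exp (-(∑ x ∈ Y, w x (ω x + ψ₀ x))) ∂(multivariateGaussian 0 Γ)) -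
          (∫ ω : EuclideanSpace ℝ ι, exp (-(∑ x ∈ Y, w x (ω x + ψ₀ x))) * -(∑ x ∈ Y, w' x (ω x + ψ₀ x) * h x) ∂(multivariateGaussian 0 Γ)) *
            (∫ ω : EuclideanSpace ℝ ι, exp (-(∑ x ∈ Y, w x (ω x + ψ₀ x))) * -(∑ x ∈ Y, w' x (ω x + ψ₀ x) * h x) ∂(multivariateGaussian 0 Γ))) /
          (∫ ω : EuclideanSpace ℝ ι, exp (-(∑ x ∈ Y, w x (ω x + ψ₀ x))) ∂(multivariateGaussian 0 Γ)) ^ 2| ≤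
      ((κ₁ ^ 3 * (Y.card : ℝ) ^ 2 * (∑ x ∈ Y, |h x| ^ 3) * L₃ + 3 * (κ₂ * (∑ x ∈ Y, h x ^ 2)) * (κ₁ * (∑ x ∈ Y, |h x|) * L₁) + κ₃ * (∑ x ∈ Y, |h x| ^ 3)) +
          3 * (κ₁ * (∑ x ∈ Y, |h x|) * L₁) * (κ₁ ^ 2 * Y.card * (∑ x ∈ Y, h x ^ 2) * L₂ + κ₂ * (∑ x ∈ Y, h x ^ 2)) + 2 * (κ₁ * (∑ x ∈ Y, |h x|) * L₁) ^ 3) / 2 ∧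
    |((∫ ω : EuclideanSpace ℝ ι, exp (-(∑ x ∈ Y, w x (ω x + (ψ₀ x + h x)))) * ((∑ x ∈ Y, w' x (ω x + (ψ₀ x + h x)) * h x) * (∑ x ∈ Y, w' x (ω x + (ψ₀ x + h x)) * h x) - (∑ x ∈ Y, w'' x (ω x + (ψ₀ x + h x)) * h x ^ 2)) ∂(multivariateGaussian 0 Γ)) *
            (∫ ω : EuclideanSpace ℝ ι, exp (-(∑ x ∈ Y, w x (ω x + (ψ₀ x + h x)))) ∂(multivariateGaussian 0 Γ)) -
          (∫ ω : EuclideanSpace ℝ ι, exp (-(∑ x ∈ Y, w x (ω x + (ψ₀ x + h x)))) * -(∑ x ∈ Y, w' x (ω x + (ψ₀ x + h x)) * h x) ∂(multivariateGaussian 0 Γ)) *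
            (∫ ω : EuclideanSpace ℝ ι, exp (-(∑ x ∈ Y, w x (ω x + (ψ₀ x + h x)))) * -(∑ x ∈ Y, w' x (ω x + (ψ₀ x + h x)) * h x) ∂(multivariateGaussian 0 Γ))) /
          (∫ ω : EuclideanSpace ℝ ι, exp (-(∑ x ∈ Y, w x (ω x + (ψ₀ x + h x)))) ∂(multivariateGaussian 0 Γ)) ^ 2 -
        ((∫ ω : EuclideanSpace ℝ ι, exp (-(∑ x ∈ Y, w x (ω x + ψ₀ x))) * ((∑ x ∈ Y, w' x (ω x + ψ₀ x) * h x) * (∑ x ∈ Y, w' x (ω x + ψ₀ x) * h x) - (∑ x ∈ Y, w'' x (ω x + ψ₀ x) * h x ^ 2)) ∂(multivariateGaussian 0 Γ)) *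
            (∫ ω : EuclideanSpace ℝ ι, exp (-(∑ x ∈ Y, w x (ω x + ψ₀ x))) ∂(multivariateGaussian 0 Γ)) -
          (∫ ω : EuclideanSpace ℝ ι, exp (-(∑ x ∈ Y, w x (ω x + ψ₀ x))) * -(∑ x ∈ Y, w' x (ω x + ψ₀ x) * h x) ∂(multivariateGaussian 0 Γ)) *
            (∫ ω : EuclideanSpace ℝ ι, exp (-(∑ x ∈ Y, w x (ω x + ψ₀ x))) * -(∑ x ∈ Y, w' x (ω x + ψ₀ x) * h x) ∂(multivariateGaussian 0 Γ))) /
          (∫ ω : EuclideanSpace ℝ ι, exp (-(∑ x ∈ Y, w x (ω x + ψ₀ x))) ∂(multivariateGaussian 0 Γ)) ^ 2| ≤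
      ((κ₁ ^ 3 * (Y.card : ℝ) ^ 2 * (∑ x ∈ Y, |h x| ^ 3) * L₃ + 3 * (κ₂ * (∑ x ∈ Y, h x ^ 2)) * (κ₁ * (∑ x ∈ Y, |h x|) * L₁) + κ₃ * (∑ x ∈ Y, |h x| ^ 3)) +
          3 * (κ₁ * (∑ x ∈ Y, |h x|) * L₁) * (κ₁ ^ 2 * Y.card * (∑ x ∈ Y, h x ^ 2) * L₂ + κ₂ * (∑ x ∈ Y, h x ^ 2)) + 2 * (κ₁ * (∑ x ∈ Y, |h x|) * L₁) ^ 3) := by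
  have hg : ∀ t ∈ Set.Icc (0 : ℝ) 1, HasDerivAt (fun t : ℝ => Real.log (∫ ω : EuclideanSpace ℝ ι, exp (-(∑ x ∈ Y, w x (ω x + (ψ₀ x + t * h x)))) ∂(multivariateGaussian 0 Γ)))
      ((∫ ω : EuclideanSpace ℝ ι, exp (-(∑ x ∈ Y, w x (ω x + (ψ₀ x + t * h x)))) * -(∑ x ∈ Y, w' x (ω x + (ψ₀ x + t * h x)) * h x) ∂(multivariateGaussian 0 Γ)) /
          (∫ ω : EuclideanSpace ℝ ι, exp (-(∑ x ∈ Y, w x (ω x + (ψ₀ x + t * h x)))) ∂(multivariateGaussian 0 Γ))) t := fun t _ =>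
    (logZ_derivs_line hΓ hΓop Y hw' hw'' hw₃ hw₃m hκ₀ hκ₁ hκ₂ hκ₃ hτ hδ hθ0 hθ1 hκθ hstab hw'b hw''b hw₃b ψ₀ h t).1
  have hg₁ : ∀ t ∈ Set.Icc (0 : ℝ) 1, HasDerivAt (fun t : ℝ => (∫ ω : EuclideanSpace ℝ ι, exp (-(∑ x ∈ Y, w x (ω x + (ψ₀ x + t * h x)))) * -(∑ x ∈ Y, w' x (ω x + (ψ₀ x + t * h x)) * h x) ∂(multivariateGaussian 0 Γ)) /
          (∫ ω : EuclideanSpace ℝ ι, exp (-(∑ x ∈ Y, w x (ω x + (ψ₀ x + t * h x)))) ∂(multivariateGaussian 0 Γ)))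
      (((∫ ω : EuclideanSpace ℝ ι, exp (-(∑ x ∈ Y, w x (ω x + (ψ₀ x + t * h x)))) * ((∑ x ∈ Y, w' x (ω x + (ψ₀ x + t * h x)) * h x) * (∑ x ∈ Y, w' x (ω x + (ψ₀ x + t * h x)) * h x) - (∑ x ∈ Y, w'' x (ω x + (ψ₀ x + t * h x)) * h x ^ 2)) ∂(multivariateGaussian 0 Γ)) *
            (∫ ω : EuclideanSpace ℝ ι, exp (-(∑ x ∈ Y, w x (ω x + (ψ₀ x + t * h x)))) ∂(multivariateGaussian 0 Γ)) -
          (∫ ω : EuclideanSpace ℝ ι, exp (-(∑ x ∈ Y, w x (ω x + (ψ₀ x + t * h x)))) * -(∑ x ∈ Y, w' x (ω x + (ψ₀ x + t * h x)) * h x) ∂(multivariateGaussian 0 Γ)) *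
            (∫ ω : EuclideanSpace ℝ ι, exp (-(∑ x ∈ Y, w x (ω x + (ψ₀ x + t * h x)))) * -(∑ x ∈ Y, w' x (ω x + (ψ₀ x + t * h x)) * h x) ∂(multivariateGaussian 0 Γ))) /
          (∫ ω : EuclideanSpace ℝ ι, exp (-(∑ x ∈ Y, w x (ω x + (ψ₀ x + t * h x)))) ∂(multivariateGaussian 0 Γ)) ^ 2) t := fun t _ =>
    (logZ_derivs_line hΓ hΓop Y hw' hw'' hw₃ hw₃m hκ₀ hκ₁ hκ₂ hκ₃ hτ hδ hθ0 hθ1 hκθ hstab hw'b hw''b hw₃b ψ₀ h t).2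
  have hg₂ : ∀ t ∈ Set.Icc (0 : ℝ) 1, HasDerivAt (fun t : ℝ => ((∫ ω : EuclideanSpace ℝ ι, exp (-(∑ x ∈ Y, w x (ω x + (ψ₀ x + t * h x)))) * ((∑ x ∈ Y, w' x (ω x + (ψ₀ x + t * h x)) * h x) * (∑ x ∈ Y, w' x (ω x + (ψ₀ x + t * h x)) * h x) - (∑ x ∈ Y, w'' x (ω x + (ψ₀ x + t * h x)) * h x ^ 2)) ∂(multivariateGaussian 0 Γ)) *
            (∫ ω : EuclideanSpace ℝ ι, exp (-(∑ x ∈ Y, w x (ω x + (ψ₀ x + t * h x)))) ∂(multivariateGaussian 0 Γ)) -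
          (∫ ω : EuclideanSpace ℝ ι, exp (-(∑ x ∈ Y, w x (ω x + (ψ₀ x + t * h x)))) * -(∑ x ∈ Y, w' x (ω x + (ψ₀ x + t * h x)) * h x) ∂(multivariateGaussian 0 Γ)) *
            (∫ ω : EuclideanSpace ℝ ι, exp (-(∑ x ∈ Y, w x (ω x + (ψ₀ x + t * h x)))) * -(∑ x ∈ Y, w' x (ω x + (ψ₀ x + t * h x)) * h x) ∂(multivariateGaussian 0 Γ))) /
          (∫ ω : EuclideanSpace ℝ ι, exp (-(∑ x ∈ Y, w x (ω x + (ψ₀ x + t * h x)))) ∂(multivariateGaussian 0 Γ)) ^ 2)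
      (((∫ ω : EuclideanSpace ℝ ι, exp (-(∑ x ∈ Y, w x (ω x + (ψ₀ x + t * h x)))) * (-((∑ x ∈ Y, w' x (ω x + (ψ₀ x + t * h x)) * h x) * (∑ x ∈ Y, w' x (ω x + (ψ₀ x + t * h x)) * h x) * (∑ x ∈ Y, w' x (ω x + (ψ₀ x + t * h x)) * h x)) + 3 * ((∑ x ∈ Y, w' x (ω x + (ψ₀ x + t * h x)) * h x) * (∑ x ∈ Y, w'' x (ω x + (ψ₀ x + t * h x)) * h x ^ 2)) - (∑ x ∈ Y, w₃ x (ω x + (ψ₀ x + t * h x)) * h x ^ 3)) ∂(multivariateGaussian 0 Γ)) *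
            (∫ ω : EuclideanSpace ℝ ι, exp (-(∑ x ∈ Y, w x (ω x + (ψ₀ x + t * h x)))) ∂(multivariateGaussian 0 Γ)) ^ 2 -
          3 * (∫ ω : EuclideanSpace ℝ ι, exp (-(∑ x ∈ Y, w x (ω x + (ψ₀ x + t * h x)))) ∂(multivariateGaussian 0 Γ)) *
            (∫ ω : EuclideanSpace ℝ ι, exp (-(∑ x ∈ Y, w x (ω x + (ψ₀ x + t * h x)))) * -(∑ x ∈ Y, w' x (ω x + (ψ₀ x + t * h x)) * h x) ∂(multivariateGaussian 0 Γ)) *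
            (∫ ω : EuclideanSpace ℝ ι, exp (-(∑ x ∈ Y, w x (ω x + (ψ₀ x + t * h x)))) * ((∑ x ∈ Y, w' x (ω x + (ψ₀ x + t * h x)) * h x) * (∑ x ∈ Y, w' x (ω x + (ψ₀ x + t * h x)) * h x) - (∑ x ∈ Y, w'' x (ω x + (ψ₀ x + t * h x)) * h x ^ 2)) ∂(multivariateGaussian 0 Γ)) +
          2 * (∫ ω : EuclideanSpace ℝ ι, exp (-(∑ x ∈ Y, w x (ω x + (ψ₀ x + t * h x)))) * -(∑ x ∈ Y, w' x (ω x + (ψ₀ x + t * h x)) * h x) ∂(multivariateGaussian 0 Γ)) ^ 3) /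
          (∫ ω : EuclideanSpace ℝ ι, exp (-(∑ x ∈ Y, w x (ω x + (ψ₀ x + t * h x)))) ∂(multivariateGaussian 0 Γ)) ^ 3) t := fun t ht =>
    (third_letter_line hΓ hΓop Y hw' hw'' hw₃ hw₃m hκ₀ hκ₁ hκ₂ hκ₃ hτ hδ hθ0 hθ1 hκθ hstab hw'b hw''b hw₃b ψ₀ h t (hI1 t ht) (hL1 t ht) (hI2 t ht) (hL2 t ht) (hI3 t ht) (hL3 t ht)).1
  have hM : ∀ t ∈ Set.Icc (0 : ℝ) 1, |((∫ ω : EuclideanSpace ℝ ι, exp (-(∑ x ∈ Y, w x (ω x + (ψ₀ x + t * h x)))) * (-((∑ x ∈ Y, w' x (ω x + (ψ₀ x + t * h x)) * h x) * (∑ x ∈ Y, w' x (ω x + (ψ₀ x + t * h x)) * h x) * (∑ x ∈ Y, w' x (ω x + (ψ₀ x + t * h x)) * h x)) + 3 * ((∑ x ∈ Y, w' x (ω x + (ψ₀ x + t * h x)) * h x) * (∑ x ∈ Y, w'' x (ω x + (ψ₀ x + t * h x)) * h x ^ 2)) - (∑ x ∈ Y, w₃ x (ω x + (ψ₀ x +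 t * h x)) * h x ^ 3)) ∂(multivariateGaussian 0 Γ)) *
            (∫ ω : EuclideanSpace ℝ ι, exp (-(∑ x ∈ Y, w x (ω x + (ψ₀ x + t * h x)))) ∂(multivariateGaussian 0 Γ)) ^ 2 -
          3 * (∫ ω : EuclideanSpace ℝ ι, exp (-(∑ x ∈ Y, w x (ω x + (ψ₀ x + t * h x)))) ∂(multivariateGaussian 0 Γ)) *
            (∫ ω : EuclideanSpace ℝ ι, exp (-(∑ x ∈ Y, w x (ω x + (ψ₀ x + t * h x)))) * -(∑ x ∈ Y, w' x (ω x + (ψ₀ x + t * h x)) * h x) ∂(multivariateGaussian 0 Γ)) *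
            (∫ ω : EuclideanSpace ℝ ι, exp (-(∑ x ∈ Y, w x (ω x + (ψ₀ x + t * h x)))) * ((∑ x ∈ Y, w' x (ω x + (ψ₀ x + t * h x)) * h x) * (∑ x ∈ Y, w' x (ω x + (ψ₀ x + t * h x)) * h x) - (∑ x ∈ Y, w'' x (ω x + (ψ₀ x + t * h x)) * h x ^ 2)) ∂(multivariateGaussian 0 Γ)) +
          2 * (∫ ω : EuclideanSpace ℝ ι, exp (-(∑ x ∈ Y, w x (ω x + (ψ₀ x + t * h x)))) * -(∑ x ∈ Y, w' x (ω x + (ψ₀ x + t * h x)) * h x) ∂(multivariateGaussian 0 Γ)) ^ 3) /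
          (∫ ω : EuclideanSpace ℝ ι, exp (-(∑ x ∈ Y, w x (ω x + (ψ₀ x + t * h x)))) ∂(multivariateGaussian 0 Γ)) ^ 3| ≤
      ((κ₁ ^ 3 * (Y.card : ℝ) ^ 2 * (∑ x ∈ Y, |h x| ^ 3) * L₃ + 3 * (κ₂ * (∑ x ∈ Y, h x ^ 2)) * (κ₁ * (∑ x ∈ Y, |h x|) * L₁) + κ₃ * (∑ x ∈ Y, |h x| ^ 3)) +
          3 * (κ₁ * (∑ x ∈ Y, |h x|) * L₁) * (κ₁ ^ 2 * Y.card * (∑ x ∈ Y, h x ^ 2) * L₂ + κ₂ * (∑ x ∈ Y, h x ^ 2)) + 2 * (κ₁ * (∑ x ∈ Y, |h x|) * L₁) ^ 3) := fun t ht =>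
    (third_letter_line hΓ hΓop Y hw' hw'' hw₃ hw₃m hκ₀ hκ₁ hκ₂ hκ₃ hτ hδ hθ0 hθ1 hκθ hstab hw'b hw''b hw₃b ψ₀ h t (hI1 t ht) (hL1 t ht) (hI2 t ht) (hL2 t ht) (hI3 t ht) (hL3 t ht)).2
  have key := taylor_third_abs_one hg hg₁ hg₂ hM
  simpa only [one_mul, zero_mul, add_zero] using key

end Main

/-! ## §3. Toy -/

/-- Toy (§1 (A)): the cubic `g(t) = t³` (`g₁ = 3t²`, `g₂ = 6t`, `g₃ ≡ 6`, `M = 6`): `|1 − 0 − 0 − 0| ≤ 6∕6`. -/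
example : |(1 : ℝ) ^ 3 - (0 : ℝ) ^ 3 - 3 * (0 : ℝ) ^ 2 - 6 * (0 : ℝ) / 2| ≤ 6 / 6 := by
  have h := (taylor_third_abs_one (g := fun t : ℝ => t ^ 3) (g₁ := fun t : ℝ => 3 * t ^ 2) (g₂ := fun t : ℝ => 6 * t)
    (g₃ := fun _ : ℝ => (6 : ℝ)) (M := 6)
    (fun t _ => by simpa using ((hasDerivAt_pow 3 t).congr_deriv (by push_cast; ring)))
    (fun t _ => ((hasDerivAt_pow 2 t).const_mul 3).congr_deriv (by push_cast; ring))
    (fun t _ => ((hasDerivAt_id' t).const_mul 6).congr_deriv (by ring))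
    (fun t _ => by norm_num)).1
  exact h

end Summit.QuantumFields.BalabanUV.T4Continuum.NE7b.SupNextPotentialCubicTaylor
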